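import Mathlib
import HarnessLib
import Summits.HubbardSuperconductivity.HubbardSuperconductivity.Theorems.KLProgrammeKLRegimeEnginePairLadderFamilyStep
import Summits.HubbardSuperconductivity.HubbardSuperconductivity.Theorems.KLProgrammeKLRegimeSplitEdgeFactsTransferLines
import Summits.HubbardSuperconductivity.HubbardSuperconductivity.Theorems.KLProgrammeKLRegimeEngineV8PairTransferExport5

/-!
# Route `KLProgramme` — ENGINE child gen 8 (stmt-HubbardSuperconductivity-20437 `KLRegimeEngineV17F2`), skeleton v2 class #5 rev 3 (RELATIVE family), stub (c):
# the DIRECT consumer door — (E2-F2) from the relative pinned clause WITH ITS OWN BAR, no hosting through `transferBarAt`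
# (cell gate-hubbard-kl, seat hubbard-kl-p1 g14 = class-#5 text / door owner (R54d); located finding «(X).3-CAP-RIGID», KL STATUS 2026-08-28)

WHY.  The chain of record (KLTC-INDEX-v8 §B.2) consumes the relative family `PairTransferRelFamilyK5 … (n−1)` at the pinned pair `(s_{n−1,n} | s_{n−1,n−1} = 0)` by
HOSTING its bar `transferBarRelIdx … (n−1) (n−1)` (prefactor `≤ 2r`, mass `15367`) under rev 2's single-prefactor absolute bar `transferBarAt L G P r′ β U (n−1)`
(`2r·15367 ≤ r′`, forced by the constant-free cubic / `1/L` / same-`G` thermal slots of `transferBarAt`) and then feeding `pairLadderStepAtV17F2_of_pairTransferPinnedAt`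
(p581707), whose fit into the frozen (E2-F2)ₙ line is `G`-scaling-invariant in the ph slot (`r′·G.phGain (n−1) ≤ 4r′·G.phGain n` against `(1 − s_Ea)·G.phGain n`:
`4r′ ≤ 1 − s_Ea`).  The two links compose to the numeric cap `r ≤ (1 − s_Ea)/(8·15367) ≈ 2⁻¹⁷` (`klCTcap = 2⁻¹⁹`, Export6) on the producer's prefactor — while the
producer's per-step room `klIdxPrefactor r (n+1)·(KlamU)²·u(ρ)·klIdxMass n m′` must host a one-loop mixed bubble whose constant in the index-mass currency is `≳ 1`.
Neither link is a property of the relative family: `pairLadderStepAtV17F2_of_member_fwd` (p544345) already takes an ARBITRARY history defect `R′`.  This file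
supplies the door that reads the relative pinned clause with its own bar `Tb`, so that every slot of the inherited bar meets the (E2-F2)ₙ line with a RAISABLE
coefficient (`C` of `addShellLog`, `Q.CR`, `Q.CL`, and — once the family is keyed at a thermal package `Gth` distinct from the engine's `G` — `Gth.CF/G.CF`):
* §1 **`pairLadderStepAtV17F2_of_pairTransferAtBar`** — p546910 with `transferBarAt … (n−1)` replaced by a generic per-class bar `Tb Qm` (history data = weight `t`
  with mass `≤ G.bhi/4` and sign line, right inverse, defect `≤ Tb` on the bare ball); **`pairLadderStepAtV17F2_of_pairTransferRelAt_zero`** — the same from the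
  RELATIVE clause `PairTransferRelAt … (n−1) Tb φ 0` of an admissible `φ` (mass/sign lines discharged by `klTransferWeight_massLine/_signLine` under
  `FrameOK R U N μ (K_{n−1})`, `klBetaMin ≤ β ≤ L`, `2^18 ≤ G.bhi`); **`pairLadderStepAtV17F2_of_relFamilyK5`** — keyed to the index family of record at ANY
  thermal package `Gth` (`Tb := transferBarRelIdx L Gth P r β U (n−1) (n−1)`, member `s_{n−1,n}`).
* §2 the CONTENT of the inherited bar in scale-`n` shapes, slot by slot: **`transferBarRelIdx_pinned_le_succ_shapes`**
  (`≤ 2r·15367·{(KlamU)²[4(klRelGain (n+1) ρ_d + 2^{−(n+1)}) + 4(klRelGain (n+1) ρ_x + 2^{−(n+1)}) + 1/L] + 2(Klam|U|)³2^{−(n+1)} + thermalBar Gth (n+1)}`) and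
  **`transferBarRelIdx_pinned_le_slots`**: at the engine package `G = G₀.addShellLog C` the ph/floor content is `≤ (8r·15367/C)·(KlamU)²·(G.phGain (n+1) ρ_d +
  G.phGain (n+1) ρ_x)` — share `8r·15367/C` (`= r·2⁻³⁵·15367·8/… ` at `C = 2⁵²`), the cubic content `4r·15367·(Klam|U|)³2^{−(n+1)}` (vs `Q.CR`), the `1/L` content
  `2r·15367·(KlamU)²/L` (vs `Q.CL`), the thermal content `2r·15367·thermalBar Gth (n+1) = 2r·15367·(Gth.CF/G.CF)·thermalBar G (n+1)` (`thermalBar_eq_mul_thermalBar`).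
Exact algebra over landed lemmas; nothing about the model's sizes is asserted (the relative clause is the class-#5 producer's obligation, the tower the (c) closer's);
nothing asserts superconductivity.  0 kit · 0 lit.
-/

noncomputable section

namespace Summit.HubbardSuperconductivity.HubbardSuperconductivity.Theorems.KLRegimeSplit

set_option linter.dupNamespace false -- summit = problem name (single-conjunct summit), D-0017

open Finset Matrix Literature.MathematicalPhysics.QuantumLattice Literature.Probability.LatticeModels
open Summit.HubbardSuperconductivity.HubbardSuperconductivity.Theorems.KLProgrammeLegKernels
open Summit.HubbardSuperconductivity.HubbardSuperconductivity.Theorems.EngineV8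

/-! ## §1 The direct doors -/

section Door

variable (L M : ℕ) [NeZero L] [NeZero M]

/-- **(E2-F2) `PairLadderStepAtV17F2 … n` (`1 ≤ n`) from a history member AT A GENERIC BAR `Tb`, BY NAME** — p546910 (`pairLadderStepAtV17F2_of_pairTransferAtCov`)
with `transferBarAt … (n−1) Qm` replaced by `Tb Qm` throughout: per pair class at resolution `n−1` the history supplies a weight `t` (mass `≤ G.bhi/4`, sign line
`Σ(|t|+t) ≤ klEdge G (n−1) |Qm|`), a right inverse `Mt` of `1 − diag t·klPairArrayF (n−1) Qm` and the defect of the member amplitude (smearing `D`) against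
`klPairArrayF (n−1) Qm·Mt`, `≤ Tb Qm` on the bare ball; the caller's tower data are p546910's with `Tb`. -/
theorem pairLadderStepAtV17F2_of_pairTransferAtBar {G : GeoConsts} {P : SplitConsts} {Q : EngConsts} {β U μ : ℝ} {n : ℕ} {m : ℝ}
    {D : Matrix (HubbardFieldIdx L M) (HubbardFieldIdx L M) ℂ} {Tb : TorusSite 2 L → TorusSite 2 L → TorusSite 2 L → ℝ}
    (hn : 1 ≤ n) (hG : 0 ≤ G.bhi) (hm : 0 ≤ m)
    (hC₀ : ∀ Qm s t, ‖klPairArrayF L M β U μ (n - 1) Qm s t‖ ≤ m)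
    (hhist : ∀ Qm : TorusSite 2 L, IsPairClassAt L Qm (n - 1) →
      ∃ t : TorusSite 2 L → ℝ, (∑ p, |t p| ≤ G.bhi / 4) ∧ (∑ p, (|t p| + t p) ≤ klEdge G (n - 1) (klTorusNorm L Qm)) ∧
        ∃ Mt : Matrix (TorusSite 2 L) (TorusSite 2 L) ℂ,
          (1 - diagonal (fun p => (t p : ℂ)) * klPairArrayF L M β U μ (n - 1) Qm) * Mt = 1 ∧
          ∀ k ∈ klBall L μ 0, ∀ k' ∈ klBall L μ 0,
            ‖klCovSmearedPairAmplitude L M β U μ (klFlowFrameU L M β U μ (n - 1)) (n - 1) D Qm k k' - (klPairArrayF L M β U μ (n - 1) Qm * Mt) k k'‖ ≤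
              Tb Qm k k')
    (hTb0 : ∀ Qm k k', 0 ≤ Tb Qm k k')
    (hsm₀ : m * (G.bhi / 4) ≤ 1 / 3)
    (htower : ∀ Qm : TorusSite 2 L, IsPairClassAt L Qm n →
      ∃ (X N : Matrix (TorusSite 2 L) (TorusSite 2 L) ℂ) (w₁ : TorusSite 2 L → ℝ) (Ea E₁ : TorusSite 2 L → TorusSite 2 L → ℝ) (r' e₁ : ℝ),
        0 ≤ r' ∧ 0 ≤ e₁ ∧
        (∀ x y, ¬(x ∈ klBall L μ 0 ∧ y ∈ klBall L μ 0) → X x y = 0) ∧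
        (∀ k ∈ klBall L μ 0, ∀ k' ∈ klBall L μ 0,
          X k k' = klCovSmearedPairAmplitude L M β U μ (klFlowFrameU L M β U μ (n - 1)) (n - 1) D Qm k k') ∧
        (∀ x y, 0 ≤ Ea x y) ∧
        (1 + diagonal (fun p => (w₁ p : ℂ)) * X) * N = 1 ∧
        (∀ k ∈ klBall L μ 0, ∀ k' ∈ klBall L μ 0, ‖klPairArrayF L M β U μ n Qm k k' - (X * N) k k'‖ ≤ Ea k k') ∧
        (∀ x y, Tb Qm x y ≤ r') ∧
        (∀ x y, Ea x y + (Tb Qm x y +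
            3 / 2 * (3 / 2 * m) * ∑ t, Tb Qm x t * |w₁ t| +
            3 / 2 * (3 / 2 * m + r') * ∑ a, |w₁ a| * Tb Qm a y +
            9 / 4 * (3 / 2 * m + r') * (3 / 2 * m) * ∑ a, ∑ t, |w₁ a| * Tb Qm a t * |w₁ t|) ≤ E₁ x y) ∧
        (∀ x y, E₁ x y ≤ e₁) ∧
        (3 / 2 * m + r') * ∑ a, |w₁ a| ≤ 1 / 3 ∧
        (∑ p, |w₁ p| ≤ 3 / 4 * G.bhi) ∧
        (∑ p, (|w₁ p| - w₁ p) ≤ klEdge G n (klTorusNorm L Qm)) ∧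
        (∀ k ∈ klBall L μ 0, ∀ k' ∈ klBall L μ 0,
          E₁ k k' ≤
            drivePBar G P U (n - 1) + eremBar G P Q U β L (n - 1) + thermalBar G P U β n +
              legDressBarQ2 G P Q U n (legSliceCountT L β μ (klFlowFrameU L M β U μ n) n ![k', Qm - k', Qm - k, k]) +
              (P.Klam * U) ^ 2 * (G.phGain n (klTorusNorm L (k - k')) + G.phGain n (klTorusNorm L (k + k' - Qm))) +
              frameShiftBar P Q U n)) :
    PairLadderStepAtV17F2 L M G P Q β U μ n := by
  refine pairLadderStepAtV17F2_of_member_fwd L M hn hm hC₀ fun Qm hQm => ?_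
  -- the history member at resolution `n − 1` (pair classes are nested)
  have hQm' : IsPairClassAt L Qm (n - 1) := isPairClassAt_mono L hQm (Nat.sub_le n 1)
  obtain ⟨t, htmass, htneg, Mt, hMt, hbd⟩ := hhist Qm hQm'
  obtain ⟨X, N, w₁, Ea, E₁, r', e₁, hr', he₁, hX0, hXeq, hEa0, hN, hEa, hR'e, hE₁, hE₁e, hsm₁, hw₁mass, hw₁neg, hbud⟩ := htower Qm hQm
  -- the history defect against the caller's array `X`
  have hR' : ∀ k ∈ klBall L μ 0, ∀ k' ∈ klBall L μ 0, ‖X k k' - (klPairArrayF L M β U μ (n - 1) Qm * Mt) k k'‖ ≤ Tb Qm k k' := by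
    intro k hk k' hk'
    rw [hXeq k hk k' hk']
    exact hbd k hk k' hk'
  -- smallness of the history weight
  have hsm₀' : m * ∑ a, |t a| ≤ 1 / 3 := (mul_le_mul_of_nonneg_left htmass hm).trans hsm₀
  -- the composite weight's two mass lines
  have hmass : ∑ p, |w₁ p - t p| ≤ G.bhi := by
    calc ∑ p, |w₁ p - t p| ≤ ∑ p, (|w₁ p| + |t p|) := sum_le_sum fun p _ => abs_sub _ _
      _ = ∑ p, |w₁ p| + ∑ p, |t p| := sum_add_distrib
      _ ≤ 3 / 4 * G.bhi + G.bhi / 4 := add_le_add hw₁mass htmass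
      _ = G.bhi := by ring
  have hρ0 : 0 ≤ klTorusNorm L Qm := by unfold klTorusNorm; exact torusSupNorm_nonneg _
  have hneg : ∑ p, (|w₁ p - t p| - (w₁ p - t p)) ≤ 2 * klEdge G n (klTorusNorm L Qm) := by
    have h1 := sum_negPart_add_le (Finset.univ : Finset (TorusSite 2 L)) w₁ (fun p => -t p)
    simp only [abs_neg, sub_neg_eq_add, ← sub_eq_add_neg] at h1
    have h2 : klEdge G (n - 1) (klTorusNorm L Qm) ≤ klEdge G n (klTorusNorm L Qm) := klEdge_mono_scale hG hρ0 (Nat.sub_le n 1)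
    linarith
  exact ⟨X, Mt, N, t, w₁, fun x y => Tb Qm x y, Ea, E₁, r', e₁, hr', he₁, hX0, fun x y => hTb0 Qm x y, hEa0,
    hMt, hR', hR'e, hN, hEa, hE₁, hE₁e, hsm₀', hsm₁, hmass, hneg, hbud⟩

/-- **(E2-F2) `PairLadderStepAtV17F2 … n` (`1 ≤ n`) from the RELATIVE pinned clause `PairTransferRelAt … (n−1) Tb φ 0` of an admissible member `φ` WITH ITS OWN BAR `Tb`**
(no hosting under `transferBarAt`): the pinned weight's mass/sign lines are discharged by `klTransferWeight_massLine/_signLine` under `FrameOK R U N μ (K_{n−1})`,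
`klBetaMin ≤ β ≤ L`, `2^18 ≤ G.bhi`; `A°_{n−1}[0] = klPairArrayF (n−1)` (`klMemberArrayF_zero`), `t_{n−1}[0] = 0` (`klTransferWeight_zero_symbol`); the caller's tower data are
p581707's with `transferBarAt … (n−1) Qm ↦ Tb Qm`. -/
theorem pairLadderStepAtV17F2_of_pairTransferRelAt_zero {G : GeoConsts} {P : SplitConsts} {Q : EngConsts} {R : RenConsts} {N : ℕ} {β U μ : ℝ} {n : ℕ} {m : ℝ}
    {φ : FreqMomentum L M → ℝ} {Tb : TorusSite 2 L → TorusSite 2 L → TorusSite 2 L → ℝ} (hn : 1 ≤ n) (hm : 0 ≤ m)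
    (hK : FrameOK R U N μ (klFlowFrameU L M β U μ (n - 1))) (hβ : klBetaMin ≤ β) (hβL : β ≤ L) (hG : (2 : ℝ) ^ 18 ≤ G.bhi)
    (hφ : IsSoftSymbol L M β μ (klFlowFrameU L M β U μ (n - 1)) (n - 1) φ)
    (hrel : PairTransferRelAt L M β U μ (n - 1) Tb φ (fun _ => 0))
    (hTb0 : ∀ Qm k k', 0 ≤ Tb Qm k k')
    (hC₀ : ∀ Qm s t, ‖klPairArrayF L M β U μ (n - 1) Qm s t‖ ≤ m)
    (hsm₀ : m * (G.bhi / 4) ≤ 1 / 3)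
    (htower : ∀ Qm : TorusSite 2 L, IsPairClassAt L Qm n →
      ∃ (X N : Matrix (TorusSite 2 L) (TorusSite 2 L) ℂ) (w₁ : TorusSite 2 L → ℝ) (Ea E₁ : TorusSite 2 L → TorusSite 2 L → ℝ) (r' e₁ : ℝ),
        0 ≤ r' ∧ 0 ≤ e₁ ∧
        (∀ x y, ¬(x ∈ klBall L μ 0 ∧ y ∈ klBall L μ 0) → X x y = 0) ∧
        (∀ k ∈ klBall L μ 0, ∀ k' ∈ klBall L μ 0,
          X k k' = klCovSmearedPairAmplitude L M β U μ (klFlowFrameU L M β U μ (n - 1)) (n - 1)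
            (softCovOf L M β μ (klFlowFrameU L M β U μ (n - 1)) φ) Qm k k') ∧
        (∀ x y, 0 ≤ Ea x y) ∧
        (1 + diagonal (fun p => (w₁ p : ℂ)) * X) * N = 1 ∧
        (∀ k ∈ klBall L μ 0, ∀ k' ∈ klBall L μ 0, ‖klPairArrayF L M β U μ n Qm k k' - (X * N) k k'‖ ≤ Ea k k') ∧
        (∀ x y, Tb Qm x y ≤ r') ∧
        (∀ x y, Ea x y + (Tb Qm x y +
            3 / 2 * (3 / 2 * m) * ∑ t, Tb Qm x t * |w₁ t| +
            3 / 2 * (3 / 2 * m + r') * ∑ a, |w₁ a| * Tb Qm a y +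
            9 / 4 * (3 / 2 * m + r') * (3 / 2 * m) * ∑ a, ∑ t, |w₁ a| * Tb Qm a t * |w₁ t|) ≤ E₁ x y) ∧
        (∀ x y, E₁ x y ≤ e₁) ∧
        (3 / 2 * m + r') * ∑ a, |w₁ a| ≤ 1 / 3 ∧
        (∑ p, |w₁ p| ≤ 3 / 4 * G.bhi) ∧
        (∑ p, (|w₁ p| - w₁ p) ≤ klEdge G n (klTorusNorm L Qm)) ∧
        (∀ k ∈ klBall L μ 0, ∀ k' ∈ klBall L μ 0,
          E₁ k k' ≤
            drivePBar G P U (n - 1) + eremBar G P Q U β L (n - 1) + thermalBar G P U β n +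
              legDressBarQ2 G P Q U n (legSliceCountT L β μ (klFlowFrameU L M β U μ n) n ![k', Qm - k', Qm - k, k]) +
              (P.Klam * U) ^ 2 * (G.phGain n (klTorusNorm L (k - k')) + G.phGain n (klTorusNorm L (k + k' - Qm))) +
              frameShiftBar P Q U n)) :
    PairLadderStepAtV17F2 L M G P Q β U μ n := by
  have hG0 : 0 ≤ G.bhi := le_trans (by positivity) hG
  refine pairLadderStepAtV17F2_of_pairTransferAtBar L M hn hG0 hm hC₀ (fun Qm hQm' => ?_) hTb0 hsm₀ htower
  obtain ⟨Mt, hMt, -, hbd⟩ := hrel Qm hQm'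
  have hw : (fun p => ((klTransferWeight L M β μ (klFlowFrameU L M β U μ (n - 1)) (n - 1) φ Qm p -
      klTransferWeight L M β μ (klFlowFrameU L M β U μ (n - 1)) (n - 1) (fun _ => 0) Qm p : ℝ) : ℂ)) =
      fun p => (klTransferWeight L M β μ (klFlowFrameU L M β U μ (n - 1)) (n - 1) φ Qm p : ℂ) := by
    funext p; rw [klTransferWeight_zero_symbol, sub_zero]
  rw [hw, klMemberArrayF_zero] at hMt
  refine ⟨fun p => klTransferWeight L M β μ (klFlowFrameU L M β U μ (n - 1)) (n - 1) φ Qm p,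
    klTransferWeight_massLine hK hβ hβL hG hφ Qm hQm', klTransferWeight_signLine hK hβ hβL hG hφ Qm hQm', Mt, hMt, fun k hk k' hk' => ?_⟩
  have hb := hbd k hk k' hk'
  rw [klMemberArrayF_zero, klMemberArrayF_apply_of_mem β U μ (n - 1) φ Qm hk hk'] at hb
  exact hb

/-- **(E2-F2) `PairLadderStepAtV17F2 … n` (`1 ≤ n ≤ nScales β + 1`) from the INDEX FAMILY OF RECORD `PairTransferRelFamilyK5 L M Gth P r β U μ (n−1)` at ANY thermal
package `Gth`, DIRECTLY** — the member consumed is `s_{n−1,n}`, the pair `(s_{n−1,n} | s_{n−1,n−1} = 0)`, the bar `Tb := transferBarRelIdx L Gth P r β U (n−1) (n−1)`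
(`0 ≤ r`, `0 ≤ P.Klam`, `0 ≤ Gth.CF`); no `transferBarAt`, no `klCTpin`, no cap.  The caller's tower data are p581707's with that `Tb`. -/
theorem pairLadderStepAtV17F2_of_relFamilyK5 {G Gth : GeoConsts} (hCF : 0 ≤ Gth.CF) {P : SplitConsts} (hKl : 0 ≤ P.Klam) {Q : EngConsts} {R : RenConsts} {N : ℕ}
    {r β U μ : ℝ} (hr : 0 ≤ r) {n : ℕ} {m : ℝ} (hn : 1 ≤ n) (hnS : n ≤ nScales β + 1) (hm : 0 ≤ m)
    (hK : FrameOK R U N μ (klFlowFrameU L M β U μ (n - 1))) (hβ : klBetaMin ≤ β) (hβL : β ≤ L) (hG : (2 : ℝ) ^ 18 ≤ G.bhi)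
    (hfam : PairTransferRelFamilyK5 L M Gth P r β U μ (n - 1))
    (hC₀ : ∀ Qm s t, ‖klPairArrayF L M β U μ (n - 1) Qm s t‖ ≤ m)
    (hsm₀ : m * (G.bhi / 4) ≤ 1 / 3)
    (htower : ∀ Qm : TorusSite 2 L, IsPairClassAt L Qm n →
      ∃ (X N : Matrix (TorusSite 2 L) (TorusSite 2 L) ℂ) (w₁ : TorusSite 2 L → ℝ) (Ea E₁ : TorusSite 2 L → TorusSite 2 L → ℝ) (r' e₁ : ℝ),
        0 ≤ r' ∧ 0 ≤ e₁ ∧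
        (∀ x y, ¬(x ∈ klBall L μ 0 ∧ y ∈ klBall L μ 0) → X x y = 0) ∧
        (∀ k ∈ klBall L μ 0, ∀ k' ∈ klBall L μ 0,
          X k k' = klCovSmearedPairAmplitude L M β U μ (klFlowFrameU L M β U μ (n - 1)) (n - 1)
            (softCovOf L M β μ (klFlowFrameU L M β U μ (n - 1)) (softSymbolCompl L M β μ (klFlowFrameU L M β U μ (n - 1)) (n - 1) n)) Qm k k') ∧
        (∀ x y, 0 ≤ Ea x y) ∧
        (1 + diagonal (fun p => (w₁ p : ℂ)) * X) * N = 1 ∧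
        (∀ k ∈ klBall L μ 0, ∀ k' ∈ klBall L μ 0, ‖klPairArrayF L M β U μ n Qm k k' - (X * N) k k'‖ ≤ Ea k k') ∧
        (∀ x y, transferBarRelIdx L Gth P r β U (n - 1) (n - 1) Qm x y ≤ r') ∧
        (∀ x y, Ea x y + (transferBarRelIdx L Gth P r β U (n - 1) (n - 1) Qm x y +
            3 / 2 * (3 / 2 * m) * ∑ t, transferBarRelIdx L Gth P r β U (n - 1) (n - 1) Qm x t * |w₁ t| +
            3 / 2 * (3 / 2 * m + r') * ∑ a, |w₁ a| * transferBarRelIdx L Gth P r β U (n - 1) (n - 1) Qm a y +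
            9 / 4 * (3 / 2 * m + r') * (3 / 2 * m) * ∑ a, ∑ t, |w₁ a| * transferBarRelIdx L Gth P r β U (n - 1) (n - 1) Qm a t * |w₁ t|) ≤
          E₁ x y) ∧
        (∀ x y, E₁ x y ≤ e₁) ∧
        (3 / 2 * m + r') * ∑ a, |w₁ a| ≤ 1 / 3 ∧
        (∑ p, |w₁ p| ≤ 3 / 4 * G.bhi) ∧
        (∑ p, (|w₁ p| - w₁ p) ≤ klEdge G n (klTorusNorm L Qm)) ∧
        (∀ k ∈ klBall L μ 0, ∀ k' ∈ klBall L μ 0,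
          E₁ k k' ≤
            drivePBar G P U (n - 1) + eremBar G P Q U β L (n - 1) + thermalBar G P U β n +
              legDressBarQ2 G P Q U n (legSliceCountT L β μ (klFlowFrameU L M β U μ n) n ![k', Qm - k', Qm - k, k]) +
              (P.Klam * U) ^ 2 * (G.phGain n (klTorusNorm L (k - k')) + G.phGain n (klTorusNorm L (k + k' - Qm))) +
              frameShiftBar P Q U n)) :
    PairLadderStepAtV17F2 L M G P Q β U μ n := by
  have hrel := hfam n (n - 1) le_rfl (Nat.sub_le n 1) hnS
  rw [softSymbolCompl_self] at hrel
  exact pairLadderStepAtV17F2_of_pairTransferRelAt_zero L M hn hm hK hβ hβL hG (isSoftSymbol_compl β μ _ (Nat.sub_le n 1)) hrel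
    (fun Qm k k' => transferBarRelIdx_nonneg hCF hKl hr β U (n - 1) (n - 1) Qm k k') hC₀ hsm₀ htower

end Door

/-! ## §2 The content of the inherited bar, slot by slot, in the next scale's shapes -/

section Content

variable {L : ℕ}

/-- `thermalBar` is LINEAR in `CF`: `thermalBar Gth … = (Gth.CF / G.CF)·thermalBar G …` for `G.CF ≠ 0` — the thermal content of a `Gth`-keyed relative bar meets the
engine's thermal slot with the RAISABLE ratio `Gth.CF/G.CF`. -/
theorem thermalBar_eq_mul_thermalBar {G Gth : GeoConsts} (hCF : G.CF ≠ 0) (P : SplitConsts) (U β : ℝ) (n : ℕ) :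
    thermalBar Gth P U β n = Gth.CF / G.CF * thermalBar G P U β n := by
  unfold thermalBar
  field_simp

/-- **The PINNED relative bar at scale `n`, bounded by scale-`(n+1)` shapes** (`0 ≤ r`, `0 ≤ P.Klam`, `0 ≤ Gth.CF`):
`transferBarRelIdx L Gth P r β U n n Qm k k′ ≤ 2r·15367·{(KlamU)²·[4(klRelGain (n+1) ρ_d + 2^{−(n+1)}) + 4(klRelGain (n+1) ρ_x + 2^{−(n+1)}) + 1/L] + 2(Klam|U|)³2^{−(n+1)} +
thermalBar Gth (n+1)}` — prefactor `klIdxPrefactor r n ≤ 2r`, pinned mass and overlap `15367`, `klRelGain n ≤ 4·klRelGain (n+1)` (`klRelGain_pred_le`),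
`2^{−n} = 2·2^{−(n+1)}`, floor `(4ⁿ)⁻¹ ≤ 4·2^{−(n+1)}` (so `2^{−n} + (4ⁿ)⁻¹ ≤ 8·2^{−(n+1)}`), `thermalBar n ≤ thermalBar (n+1)`. -/
theorem transferBarRelIdx_pinned_le_succ_shapes {Gth : GeoConsts} (hCF : 0 ≤ Gth.CF) {P : SplitConsts} (hKl : 0 ≤ P.Klam) {r : ℝ} (hr : 0 ≤ r) (β U : ℝ) (n : ℕ)
    (Qm k k' : TorusSite 2 L) :
    transferBarRelIdx L Gth P r β U n n Qm k k' ≤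
      2 * r * 15367 * ((P.Klam * U) ^ 2 * (4 * (klRelGain (n + 1) (klTorusNorm L (k - k')) + ((2 : ℝ) ^ (n + 1))⁻¹) +
          4 * (klRelGain (n + 1) (klTorusNorm L (k + k' - Qm)) + ((2 : ℝ) ^ (n + 1))⁻¹) + ((L : ℝ))⁻¹) +
        2 * ((P.Klam * |U|) ^ 3 * ((2 : ℝ) ^ (n + 1))⁻¹) + thermalBar Gth P U β (n + 1)) := by
  rw [transferBarRelIdx_self, transferBarRelAtWF_eq]
  set ρd := klTorusNorm L (k - k') with hρd
  set ρx := klTorusNorm L (k + k' - Qm) with hρx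
  have hρd0 : 0 ≤ ρd := by rw [hρd]; unfold klTorusNorm; exact torusSupNorm_nonneg _
  have hρx0 : 0 ≤ ρx := by rw [hρx]; unfold klTorusNorm; exact torusSupNorm_nonneg _
  -- the scale-(n+1) shapes dominate the scale-n ones
  have hgd : klRelGain n ρd ≤ 4 * klRelGain (n + 1) ρd := by simpa using klRelGain_pred_le (n + 1) hρd0
  have hgx : klRelGain n ρx ≤ 4 * klRelGain (n + 1) ρx := by simpa using klRelGain_pred_le (n + 1) hρx0
  have h2 : ((2 : ℝ) ^ n)⁻¹ = 2 * ((2 : ℝ) ^ (n + 1))⁻¹ := by rw [pow_succ]; field_simp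
  have h4 : ((4 : ℝ) ^ n)⁻¹ ≤ ((2 : ℝ) ^ n)⁻¹ := by
    refine inv_anti₀ (by positivity) ?_
    exact pow_le_pow_left₀ (by norm_num) (by norm_num) n
  have hth := thermalBar_le_succ hCF P U β n
  have hth0 : 0 ≤ thermalBar Gth P U β n := thermalBar_nonneg' hCF P U β n
  have hpref := klIdxPrefactor_le hr n
  have hpref0 := klIdxPrefactor_nonneg hr n
  have hgd0 := klRelGain_nonneg (n + 1) hρd0
  have hgx0 := klRelGain_nonneg (n + 1) hρx0
  have hU2 : 0 ≤ (P.Klam * U) ^ 2 := by positivity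
  have hU3 : 0 ≤ (P.Klam * |U|) ^ 3 := by have := mul_nonneg hKl (abs_nonneg U); positivity
  have h2n : 0 < ((2 : ℝ) ^ (n + 1))⁻¹ := by positivity
  have hL0 : 0 ≤ ((L : ℝ))⁻¹ := by positivity
  -- the bracket at scale `n` (weights 15367) is below the scale-(n+1) bracket times 15367
  have hbr : (P.Klam * U) ^ 2 * ((klRelGain n ρd + klRelGain n ρx + ((2 : ℝ) ^ n)⁻¹ + ((L : ℝ))⁻¹) * 15367 + ((4 : ℝ) ^ n)⁻¹ * 15367) +
        ((P.Klam * |U|) ^ 3 * ((2 : ℝ) ^ n)⁻¹ + thermalBar Gth P U β n) * 15367 ≤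
      15367 * ((P.Klam * U) ^ 2 * (4 * (klRelGain (n + 1) ρd + ((2 : ℝ) ^ (n + 1))⁻¹) + 4 * (klRelGain (n + 1) ρx + ((2 : ℝ) ^ (n + 1))⁻¹) + ((L : ℝ))⁻¹) +
        2 * ((P.Klam * |U|) ^ 3 * ((2 : ℝ) ^ (n + 1))⁻¹) + thermalBar Gth P U β (n + 1)) := by
    rw [h2] at h4 ⊢
    have hA : klRelGain n ρd + klRelGain n ρx + 2 * ((2 : ℝ) ^ (n + 1))⁻¹ + ((L : ℝ))⁻¹ + ((4 : ℝ) ^ n)⁻¹ ≤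
        4 * (klRelGain (n + 1) ρd + ((2 : ℝ) ^ (n + 1))⁻¹) + 4 * (klRelGain (n + 1) ρx + ((2 : ℝ) ^ (n + 1))⁻¹) + ((L : ℝ))⁻¹ := by linarith
    have hB : (P.Klam * |U|) ^ 3 * (2 * ((2 : ℝ) ^ (n + 1))⁻¹) + thermalBar Gth P U β n ≤
        2 * ((P.Klam * |U|) ^ 3 * ((2 : ℝ) ^ (n + 1))⁻¹) + thermalBar Gth P U β (n + 1) := by linarith
    nlinarith [mul_le_mul_of_nonneg_left hA hU2, hB]
  calc klIdxPrefactor r n * ((P.Klam * U) ^ 2 * ((klRelGain n ρd + klRelGain n ρx + ((2 : ℝ) ^ n)⁻¹ + ((L : ℝ))⁻¹) * 15367 + ((4 : ℝ) ^ n)⁻¹ * 15367) +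
          ((P.Klam * |U|) ^ 3 * ((2 : ℝ) ^ n)⁻¹ + thermalBar Gth P U β n) * 15367)
      ≤ (2 * r) * (15367 * ((P.Klam * U) ^ 2 * (4 * (klRelGain (n + 1) ρd + ((2 : ℝ) ^ (n + 1))⁻¹) + 4 * (klRelGain (n + 1) ρx + ((2 : ℝ) ^ (n + 1))⁻¹) +
            ((L : ℝ))⁻¹) + 2 * ((P.Klam * |U|) ^ 3 * ((2 : ℝ) ^ (n + 1))⁻¹) + thermalBar Gth P U β (n + 1))) := by
        refine mul_le_mul hpref hbr ?_ (by positivity)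
        have h4n0 : 0 ≤ ((4 : ℝ) ^ n)⁻¹ := by positivity
        have h2n0 : 0 ≤ ((2 : ℝ) ^ n)⁻¹ := by positivity
        have := klRelGain_nonneg n hρd0
        have := klRelGain_nonneg n hρx0
        positivity
    _ = _ := by ring

/-- **The inherited content against the engine's (E2-F2) slots** at the package `G = G₀.addShellLog C` (`0 < C`, `0 ≤ G₀.phGain`; `0 ≤ r`, `0 ≤ P.Klam`, `0 ≤ Gth.CF`):
`transferBarRelIdx L Gth P r β U n n Qm k k′ ≤ (8r·15367/C)·(KlamU)²·(G.phGain (n+1) ρ_d + G.phGain (n+1) ρ_x) + 2r·15367·(KlamU)²/L + 4r·15367·(Klam|U|)³2^{−(n+1)} +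
2r·15367·thermalBar Gth (n+1)` — the ph/floor content rides `C` (`C·(klRelGain (n+1) ρ + 2^{−(n+1)}) ≤ G.phGain (n+1) ρ`), the cubic and `1/L` contents meet `Q.CR`/`Q.CL`
of `eremBar`, the thermal content meets `thermalBar G (n+1)` with the ratio `Gth.CF/G.CF` (`thermalBar_eq_mul_thermalBar`): EVERY coefficient is raisable. -/
theorem transferBarRelIdx_pinned_le_slots {G₀ Gth : GeoConsts} (hph : ∀ n ρ, 0 ≤ G₀.phGain n ρ) (hCF : 0 ≤ Gth.CF) {C : ℝ} (hC : 0 < C) {P : SplitConsts}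
    (hKl : 0 ≤ P.Klam) {r : ℝ} (hr : 0 ≤ r) (β U : ℝ) (n : ℕ) (Qm k k' : TorusSite 2 L) :
    transferBarRelIdx L Gth P r β U n n Qm k k' ≤
      8 * r * 15367 / C * ((P.Klam * U) ^ 2 * ((G₀.addShellLog C).phGain (n + 1) (klTorusNorm L (k - k')) + (G₀.addShellLog C).phGain (n + 1) (klTorusNorm L (k + k' - Qm)))) +
        2 * r * 15367 * ((P.Klam * U) ^ 2 * ((L : ℝ))⁻¹) + 4 * r * 15367 * ((P.Klam * |U|) ^ 3 * ((2 : ℝ) ^ (n + 1))⁻¹) +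
        2 * r * 15367 * thermalBar Gth P U β (n + 1) := by
  refine (transferBarRelIdx_pinned_le_succ_shapes hCF hKl hr β U n Qm k k').trans ?_
  set ρd := klTorusNorm L (k - k') with hρd
  set ρx := klTorusNorm L (k + k' - Qm) with hρx
  have hρd0 : 0 ≤ ρd := by rw [hρd]; unfold klTorusNorm; exact torusSupNorm_nonneg _
  have hρx0 : 0 ≤ ρx := by rw [hρx]; unfold klTorusNorm; exact torusSupNorm_nonneg _
  -- `C·(klRelGain (n+1) ρ + 2^{−(n+1)}) ≤ (G₀.addShellLog C).phGain (n+1) ρ`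
  have hd : C * (klRelGain (n + 1) ρd + ((2 : ℝ) ^ (n + 1))⁻¹) ≤ (G₀.addShellLog C).phGain (n + 1) ρd := by
    rw [GeoConsts.addShellLog_phGain, max_eq_left hρd0]; linarith [hph (n + 1) ρd]
  have hx : C * (klRelGain (n + 1) ρx + ((2 : ℝ) ^ (n + 1))⁻¹) ≤ (G₀.addShellLog C).phGain (n + 1) ρx := by
    rw [GeoConsts.addShellLog_phGain, max_eq_left hρx0]; linarith [hph (n + 1) ρx]
  have hU2 : 0 ≤ (P.Klam * U) ^ 2 := by positivity
  have hr0 : 0 ≤ 2 * r * 15367 := by positivity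
  -- ph/floor content: `2r·15367·(KlamU)²·4(g + 2^{-(n+1)}) ≤ (8r·15367/C)·(KlamU)²·phGain`
  have hph' : 2 * r * 15367 * ((P.Klam * U) ^ 2 * (4 * (klRelGain (n + 1) ρd + ((2 : ℝ) ^ (n + 1))⁻¹) + 4 * (klRelGain (n + 1) ρx + ((2 : ℝ) ^ (n + 1))⁻¹))) ≤
      8 * r * 15367 / C * ((P.Klam * U) ^ 2 * ((G₀.addShellLog C).phGain (n + 1) ρd + (G₀.addShellLog C).phGain (n + 1) ρx)) := by
    have hsum : klRelGain (n + 1) ρd + ((2 : ℝ) ^ (n + 1))⁻¹ + (klRelGain (n + 1) ρx + ((2 : ℝ) ^ (n + 1))⁻¹) ≤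
        ((G₀.addShellLog C).phGain (n + 1) ρd + (G₀.addShellLog C).phGain (n + 1) ρx) / C := by
      rw [le_div_iff₀ hC]; linarith
    have hkey : 2 * r * 15367 * ((P.Klam * U) ^ 2 * (4 * (klRelGain (n + 1) ρd + ((2 : ℝ) ^ (n + 1))⁻¹) + 4 * (klRelGain (n + 1) ρx + ((2 : ℝ) ^ (n + 1))⁻¹))) =
        8 * r * 15367 * ((P.Klam * U) ^ 2 * (klRelGain (n + 1) ρd + ((2 : ℝ) ^ (n + 1))⁻¹ + (klRelGain (n + 1) ρx + ((2 : ℝ) ^ (n + 1))⁻¹))) := by ring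
    rw [hkey, show 8 * r * 15367 / C * ((P.Klam * U) ^ 2 * ((G₀.addShellLog C).phGain (n + 1) ρd + (G₀.addShellLog C).phGain (n + 1) ρx)) =
      8 * r * 15367 * ((P.Klam * U) ^ 2 * (((G₀.addShellLog C).phGain (n + 1) ρd + (G₀.addShellLog C).phGain (n + 1) ρx) / C)) by ring]
    exact mul_le_mul_of_nonneg_left (mul_le_mul_of_nonneg_left hsum hU2) (by positivity)
  nlinarith [hph']

end Content

end Summit.HubbardSuperconductivity.HubbardSuperconductivity.Theorems.KLRegimeSplit

end
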